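import Mathlib.Analysis.Distribution.SchwartzSpace.Deriv
import Mathlib.Analysis.Calculus.ParametricIntegral
import Mathlib.Analysis.Calculus.Deriv.MeanValue
import Mathlib.Analysis.Calculus.Deriv.Shift
import Mathlib.Analysis.SpecialFunctions.Log.Basic
import Mathlib.Analysis.SpecialFunctions.ImproperIntegrals
import Mathlib.MeasureTheory.Function.Floor
import Mathlib.MeasureTheory.Group.Integral
import Mathlib.Analysis.Fourier.Notation
import HarnessLib

/-!
# Bernstein slope bound and automatic monotonicity above the handover height (`stub_slopeAbove`)

Route `RiemannHypothesis/SpectralTrace`, crux `WindowStep` (stmt-RiemannHypothesis-14659), line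
`floor-feedback`, stub `stub_slopeAbove` (RH-free real analysis, stated over Mathlib only).

**What is proved.** Let `Φ : ℝ → ℝ` have derivative `ρ` everywhere, let `k` be a real Schwartz
function and let `h` be a continuous solution of the floor–feedback equation
`h(T) = ∫ k(T − s) · fract(Φ(s) + h(s)) ds`.  Write `‖k′‖₁ = ∫ |k′|`.
* (Bernstein) `h` is differentiable with `h′(T) = ∫ k′(T − s) b(s) ds`, `b = fract(Φ + h)`
  (differentiation under the integral sign, `hasDerivAt_integral_of_dominated_loc_of_deriv_le`,
  the dominating function being `3M/(1 + (T − s)²)` from the Schwartz decay `|k′(x)| ≤ M/(1 + x²)`),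
  and since `∫ k′ = 0` (`integral_eq_zero_of_hasDerivAt_of_integrable`) one has
  `h′(T) = ∫ k′(T − s)(b(s) − ½) ds`, whence `|h′(T)| ≤ ‖k′‖₁/2`.
* (Monotonicity) If `ρ(T) ≥ (1/2π) log|T| − C` for `|T| ≥ T₀`, then for
  `|T| > T₁ := max T₀ (exp(2πC + π‖k′‖₁))` the derivative `ρ + h′` of `Φ + h` is positive, so
  `Φ + h` is strictly increasing on `[T₁, ∞)` and on `(−∞, −T₁]` (`strictMonoOn_of_deriv_pos`),
  and beyond `max T₀ (exp(2π(C + ‖k′‖₁/2 + 1)))` the slope is `≥ 1`, so `Φ + h → ±∞` at `±∞`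
  (`Convex.mul_sub_le_image_sub_of_le_deriv`).
-/

set_option linter.dupNamespace false

noncomputable section

open Complex Filter Set MeasureTheory
open scoped Real Topology BigOperators FourierTransform SchwartzMap

namespace Summit.RiemannHypothesis.RiemannHypothesis.Theorems.SpectralTraceWindowStep

/-! ## Schwartz decay and differentiation under the integral sign -/

/-- Quadratic decay of a real Schwartz function: `|g(x)| ≤ M/(1 + x²)` with
`M = p₀₀(g) + p₂₀(g)`. [folklore] -/
theorem stub_slopeAbove_decay (g : 𝓢(ℝ, ℝ)) :
    ∃ M : ℝ, 0 ≤ M ∧ ∀ x : ℝ, |g x| ≤ M * (1 + x ^ 2)⁻¹ := by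
  refine ⟨SchwartzMap.seminorm ℝ 0 0 g + SchwartzMap.seminorm ℝ 2 0 g,
    add_nonneg (apply_nonneg _ _) (apply_nonneg _ _), fun x => ?_⟩
  have h0 : |g x| ≤ SchwartzMap.seminorm ℝ 0 0 g := by
    simpa [Real.norm_eq_abs] using SchwartzMap.norm_le_seminorm ℝ g x
  have h2 : x ^ 2 * |g x| ≤ SchwartzMap.seminorm ℝ 2 0 g := by
    simpa [Real.norm_eq_abs, sq_abs] using SchwartzMap.norm_pow_mul_le_seminorm ℝ g 2 x
  have hpos : 0 < 1 + x ^ 2 := by positivity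
  rw [← div_eq_mul_inv, le_div_iff₀ hpos]
  nlinarith [abs_nonneg (g x)]

/-- Differentiation under the integral sign for the convolution of a real Schwartz function with a
bounded measurable function: `(k ⋆ b)′(T) = ∫ k′(T − s) b(s) ds`. [folklore] -/
theorem stub_slopeAbove_hasDerivAt_conv (k : 𝓢(ℝ, ℝ)) {b : ℝ → ℝ}
    (hb : AEStronglyMeasurable b volume) (hb1 : ∀ s, |b s| ≤ 1) (T : ℝ) :
    HasDerivAt (fun T' : ℝ => ∫ s : ℝ, k (T' - s) * b s)
      (∫ s : ℝ, deriv (fun y : ℝ => k y) (T - s) * b s) T := by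
  obtain ⟨M, hM0, hM⟩ := stub_slopeAbove_decay (SchwartzMap.derivCLM ℝ ℝ k)
  have hk1 : ∀ x, |deriv (fun y : ℝ => k y) x| ≤ M * (1 + x ^ 2)⁻¹ := fun x => by
    simpa using hM x
  have key := hasDerivAt_integral_of_dominated_loc_of_deriv_le (μ := volume) (x₀ := T)
    (F := fun T' s => k (T' - s) * b s)
    (F' := fun T' s => deriv (fun y : ℝ => k y) (T' - s) * b s)
    (bound := fun s => 3 * M * (1 + (T - s) ^ 2)⁻¹)
    (Metric.ball_mem_nhds T one_pos) ?_ ?_ ?_ ?_ ?_ ?_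
  · exact key.2
  · exact Eventually.of_forall fun T' =>
      (k.continuous.comp (continuous_const.sub continuous_id)).aestronglyMeasurable.mul hb
  · exact (k.integrable.comp_sub_left T).mul_bdd hb
      (Eventually.of_forall fun s => by simpa [Real.norm_eq_abs] using hb1 s)
  · exact ((SchwartzMap.derivCLM ℝ ℝ k).continuous.comp
      (continuous_const.sub continuous_id)).aestronglyMeasurable.mul hb
  · refine Eventually.of_forall fun s T' hT' => ?_
    have hT'1 : |T' - T| < 1 := by simpa [Real.dist_eq] using Metric.mem_ball.1 hT'
    have hcmp : (1 + (T' - s) ^ 2)⁻¹ ≤ 3 * (1 + (T - s) ^ 2)⁻¹ := by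
      rw [inv_eq_one_div, inv_eq_one_div, mul_one_div,
        div_le_div_iff₀ (by positivity) (by positivity)]
      obtain ⟨h1, h2⟩ := abs_lt.mp hT'1
      nlinarith [sq_nonneg ((T - T') - (T' - s)), sq_nonneg (T' - s),
        mul_pos (sub_pos.2 h2) (by linarith : (0 : ℝ) < 1 + (T' - T))]
    calc ‖deriv (fun y : ℝ => k y) (T' - s) * b s‖
        = |deriv (fun y : ℝ => k y) (T' - s)| * |b s| := by rw [Real.norm_eq_abs, abs_mul]
      _ ≤ M * (1 + (T' - s) ^ 2)⁻¹ * 1 :=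
          mul_le_mul (hk1 _) (hb1 s) (abs_nonneg _) (by positivity)
      _ ≤ M * (3 * (1 + (T - s) ^ 2)⁻¹) := by
          rw [mul_one]; exact mul_le_mul_of_nonneg_left hcmp hM0
      _ = 3 * M * (1 + (T - s) ^ 2)⁻¹ := by ring
  · exact (integrable_inv_one_add_sq.comp_sub_left T).const_mul (3 * M)
  · exact Eventually.of_forall fun s T' _ =>
      ((k.hasDerivAt (T' - s)).comp_sub_const T' s).mul_const (b s)

/-! ## `∫ k′ = 0` and the Bernstein bound `|h′| ≤ ‖k′‖₁/2` -/

/-- `∫ k′ = 0` for a real Schwartz function `k`. [folklore] -/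
theorem stub_slopeAbove_integral_deriv (k : 𝓢(ℝ, ℝ)) :
    ∫ x : ℝ, deriv (fun y : ℝ => k y) x = 0 :=
  integral_eq_zero_of_hasDerivAt_of_integrable (fun x => k.hasDerivAt x)
    (SchwartzMap.derivCLM ℝ ℝ k).integrable k.integrable

/-- Bernstein-type bound: for `0 ≤ b ≤ 1`, `|∫ k′(T − s) b(s) ds| ≤ ‖k′‖₁/2`
(`∫ k′(T − s) ds = 0`, so the integral equals `∫ k′(T − s)(b(s) − ½) ds`). [folklore] -/
theorem stub_slopeAbove_bound (k : 𝓢(ℝ, ℝ)) {b : ℝ → ℝ} (hb : AEStronglyMeasurable b volume)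
    (hb01 : ∀ s, 0 ≤ b s ∧ b s ≤ 1) (T : ℝ) :
    |∫ s : ℝ, deriv (fun y : ℝ => k y) (T - s) * b s| ≤
      (∫ x : ℝ, |deriv (fun y : ℝ => k y) x|) / 2 := by
  set k₁ : ℝ → ℝ := fun x => deriv (fun y : ℝ => k y) x with hk₁
  have hk₁i : Integrable k₁ := (SchwartzMap.derivCLM ℝ ℝ k).integrable
  have hTi : Integrable (fun s => k₁ (T - s)) := hk₁i.comp_sub_left T
  have h0 : ∫ s, k₁ (T - s) = 0 := by
    rw [integral_sub_left_eq_self k₁ volume T]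
    exact stub_slopeAbove_integral_deriv k
  have hbi : Integrable (fun s => k₁ (T - s) * b s) :=
    hTi.mul_bdd hb (Eventually.of_forall fun s => by
      rw [Real.norm_eq_abs]
      exact abs_le.2 ⟨by linarith [(hb01 s).1], (hb01 s).2⟩)
  have heq : ∫ s, k₁ (T - s) * b s = ∫ s, k₁ (T - s) * (b s - 1 / 2) := by
    have : ∫ s, k₁ (T - s) * (b s - 1 / 2) = (∫ s, k₁ (T - s) * b s) - 1 / 2 * ∫ s, k₁ (T - s) := by
      rw [← integral_const_mul, ← integral_sub hbi (hTi.const_mul _)]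
      congr 1
      funext s
      ring
    rw [this, h0, mul_zero, sub_zero]
  rw [heq]
  have hle : ∀ s, ‖k₁ (T - s) * (b s - 1 / 2)‖ ≤ |k₁ (T - s)| / 2 := fun s => by
    rw [Real.norm_eq_abs, abs_mul]
    have : |b s - 1 / 2| ≤ 1 / 2 := abs_le.2 ⟨by linarith [(hb01 s).1], by linarith [(hb01 s).2]⟩
    calc |k₁ (T - s)| * |b s - 1 / 2| ≤ |k₁ (T - s)| * (1 / 2) :=
          mul_le_mul_of_nonneg_left this (abs_nonneg _)
      _ = |k₁ (T - s)| / 2 := by ring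
  calc |∫ s, k₁ (T - s) * (b s - 1 / 2)| = ‖∫ s, k₁ (T - s) * (b s - 1 / 2)‖ :=
        (Real.norm_eq_abs _).symm
    _ ≤ ∫ s, |k₁ (T - s)| / 2 :=
        norm_integral_le_of_norm_le (hTi.abs.div_const 2) (Eventually.of_forall hle)
    _ = (∫ x, |k₁ x|) / 2 := by
        rw [integral_div, integral_sub_left_eq_self (fun x => |k₁ x|) volume T]

/-! ## The registered stub -/

/-- **stub_slopeAbove (Bernstein; RH-free).**  For ANY `Φ` with `Φ′ = ρ` and ANY continuous solution
`h = k ⋆ fract(Φ + h)` (`k` Schwartz): `h′ = k′ ⋆ fract(Φ + h) = k′ ⋆ (fract(Φ + h) − ½)`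
(differentiation under the integral; `∫ k′ = 0`), so `|h′| ≤ ‖k′‖₁/2`; if
`ρ(T) ≥ (1/2π) log|T| − C` for `|T| ≥ T₀` then `(Φ + h)′ > 0` for
`|T| > T₁ = max(T₀, exp(2πC + π‖k′‖₁))`, so `Φ + h` is strictly increasing on `[T₁, ∞)` and on
`(−∞, −T₁]`, and `Φ + h → ±∞` (slope `≥ 1` beyond `max(T₀, exp(2π(C + ‖k′‖₁/2 + 1)))`). [folklore] -/
theorem stub_slopeAbove :
    ∀ (Φ ρ h : ℝ → ℝ) (k : 𝓢(ℝ, ℝ)) (T₀ C : ℝ), 1 ≤ T₀ → (∀ T : ℝ, HasDerivAt Φ (ρ T) T) →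
      (∀ T : ℝ, T₀ ≤ |T| → Real.log |T| / (2 * π) - C ≤ ρ T) →
      Continuous h → (∀ T : ℝ, h T = ∫ s : ℝ, k (T - s) * Int.fract (Φ s + h s)) →
      (∀ T : ℝ, ∃ d : ℝ, HasDerivAt h d T ∧ |d| ≤ (∫ x : ℝ, |deriv (fun y : ℝ => k y) x|) / 2) ∧
      StrictMonoOn (fun T : ℝ => Φ T + h T)
        (Ici (max T₀ (Real.exp (2 * π * C + π * ∫ x : ℝ, |deriv (fun y : ℝ => k y) x|)))) ∧
      StrictMonoOn (fun T : ℝ => Φ T + h T)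
        (Iic (-max T₀ (Real.exp (2 * π * C + π * ∫ x : ℝ, |deriv (fun y : ℝ => k y) x|)))) ∧
      Tendsto (fun T : ℝ => Φ T + h T) atTop atTop ∧ Tendsto (fun T : ℝ => Φ T + h T) atBot atBot := by
  intro Φ ρ h k T₀ C _hT₀ hΦ hρ hh hfb
  -- the slope budget `s₁ = ‖k′‖₁` and the feedback `b = fract(Φ + h)`
  set s₁ : ℝ := ∫ x : ℝ, |deriv (fun y : ℝ => k y) x| with hs₁
  set b : ℝ → ℝ := fun s => Int.fract (Φ s + h s) with hb
  have hΦc : Continuous Φ := continuous_iff_continuousAt.2 fun T => (hΦ T).continuousAt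
  have hbm : AEStronglyMeasurable b volume :=
    ((hΦc.add hh).measurable.fract).aestronglyMeasurable
  have hb01 : ∀ s, 0 ≤ b s ∧ b s ≤ 1 := fun s => ⟨Int.fract_nonneg _, (Int.fract_lt_one _).le⟩
  have hb1 : ∀ s, |b s| ≤ 1 := fun s => abs_le.2 ⟨by linarith [(hb01 s).1], (hb01 s).2⟩
  -- the derivative `d = h′`
  set d : ℝ → ℝ := fun T => ∫ s : ℝ, deriv (fun y : ℝ => k y) (T - s) * b s with hd
  have hhd : ∀ T, HasDerivAt h (d T) T := fun T =>
    (stub_slopeAbove_hasDerivAt_conv k hbm hb1 T).congr_of_eventuallyEq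
      (Eventually.of_forall fun T' => hfb T')
  have hdb : ∀ T, |d T| ≤ s₁ / 2 := fun T => stub_slopeAbove_bound k hbm hb01 T
  -- `G = Φ + h`, `G′ = ρ + d`
  have hG : ∀ T, HasDerivAt (fun T : ℝ => Φ T + h T) (ρ T + d T) T := fun T => (hΦ T).add (hhd T)
  have hGc : Continuous fun T : ℝ => Φ T + h T := hΦc.add hh
  have hGd : ∀ T, deriv (fun T : ℝ => Φ T + h T) T = ρ T + d T := fun T => (hG T).deriv
  -- the density floor beyond the height `max T₀ (exp(2π(C + L)))` gives slope `> L − s₁/2`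
  have hkey : ∀ L T : ℝ, max T₀ (Real.exp (2 * π * (C + L))) < |T| →
      L - s₁ / 2 < deriv (fun T : ℝ => Φ T + h T) T := by
    intro L T hT
    have hT₀ : T₀ ≤ |T| := (le_max_left _ _).trans hT.le
    have hexp : Real.exp (2 * π * (C + L)) < |T| := (le_max_right _ _).trans_lt hT
    have hpos : 0 < |T| := (Real.exp_pos _).trans hexp
    have hlog : 2 * π * (C + L) < Real.log |T| := (Real.lt_log_iff_exp_lt hpos).2 hexp
    have h1 : C + L < Real.log |T| / (2 * π) := by
      rw [lt_div_iff₀ (by positivity)]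
      linarith
    have h2 := hρ T hT₀
    have h3 : -(s₁ / 2) ≤ d T := by linarith [neg_abs_le (d T), hdb T]
    rw [hGd]
    linarith
  have hT₁eq : 2 * π * C + π * s₁ = 2 * π * (C + s₁ / 2) := by ring
  have hpos' : ∀ T, max T₀ (Real.exp (2 * π * C + π * s₁)) < |T| →
      0 < deriv (fun T : ℝ => Φ T + h T) T := by
    intro T hT
    have := hkey (s₁ / 2) T (by rwa [← hT₁eq])
    linarith
  -- slope `≥ 1` beyond `T₂`
  set T₂ : ℝ := max T₀ (Real.exp (2 * π * (C + (s₁ / 2 + 1)))) with hT₂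
  have hge1 : ∀ T, T₂ < |T| → (1 : ℝ) ≤ deriv (fun T : ℝ => Φ T + h T) T := by
    intro T hT
    have := hkey (s₁ / 2 + 1) T hT
    linarith
  refine ⟨fun T => ⟨d T, hhd T, hdb T⟩, ?_, ?_, ?_, ?_⟩
  · refine strictMonoOn_of_deriv_pos (convex_Ici _) hGc.continuousOn fun x hx => ?_
    rw [interior_Ici] at hx
    exact hpos' x (lt_of_lt_of_le hx (le_abs_self x))
  · refine strictMonoOn_of_deriv_pos (convex_Iic _) hGc.continuousOn fun x hx => ?_
    rw [interior_Iic, mem_Iio] at hx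
    exact hpos' x (by linarith [neg_le_abs x])
  · have hmv := (convex_Ici T₂).mul_sub_le_image_sub_of_le_deriv hGc.continuousOn
      (fun x _ => (hG x).differentiableAt.differentiableWithinAt)
      (fun x hx => by
        rw [interior_Ici] at hx
        exact hge1 x (lt_of_lt_of_le hx (le_abs_self x)))
    refine tendsto_atTop_mono' atTop ?_
      (tendsto_atTop_add_const_left atTop (Φ T₂ + h T₂ - T₂) tendsto_id)
    refine (eventually_ge_atTop T₂).mono fun T hT => ?_
    have := hmv T₂ (mem_Ici.2 le_rfl) T (mem_Ici.2 hT) hT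
    simp only [id]
    linarith
  · have hmv := (convex_Iic (-T₂)).mul_sub_le_image_sub_of_le_deriv hGc.continuousOn
      (fun x _ => (hG x).differentiableAt.differentiableWithinAt)
      (fun x hx => by
        rw [interior_Iic, mem_Iio] at hx
        exact hge1 x (by linarith [neg_le_abs x]))
    refine tendsto_atBot_mono' atBot ?_
      (tendsto_atBot_add_const_left atBot (Φ (-T₂) + h (-T₂) + T₂) tendsto_id)
    refine (eventually_le_atBot (-T₂)).mono fun T hT => ?_
    have := hmv T (mem_Iic.2 hT) (-T₂) (mem_Iic.2 le_rfl) hT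
    simp only [id]
    linarith

end Summit.RiemannHypothesis.RiemannHypothesis.Theorems.SpectralTraceWindowStep

end
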